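import Summits.ValiantsHypothesis.ValiantsHypothesis.Theorems.PolyaContinuedMonotoneCoverHardRowLevelled

/-!
# Crux `MonotoneCoverHard` (stmt-ValiantsHypothesis-7421), width line — RUNG: **label-levelled Pfaffian
covers are row- or column-levelled**, hence have all widths ≤ 2 and satisfy the crux

(val-width-7421-p4 g0, 2026-08-28; lane «width ≥ 3 at one level ⇒ non-Pfaffian».)

A levelled cover of `per_n` is LABEL-LEVELLED if the row level of a used variable edge is a function
`L` of its LABEL `x_{k l}` (the same variable is always read at the same level).  This file shows that
label-levelled forces row-levelled or column-levelled (`…RowLevelled.lean`), so the crux holds for all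
label-levelled Pfaffian covers:

* `exchange_of_labelLevelled` — width-profile invariance (`varCount_eq`) applied to the matchings
  realising `σ` and `σ ∘ (k k')` gives the EXCHANGE IDENTITY
  `[L(k,l) = ℓ] + [L(k',l') = ℓ] = [L(k,l') = ℓ] + [L(k',l) = ℓ]` for `k ≠ k'`, `l ≠ l'`;
* `rowConst_or_colConst_of_exchange` — a function on `Fin n × Fin n` with the exchange identity is
  constant on rows or constant on columns (a set of cells meeting every permutation matrix in the same
  number of cells is a union of rows or a union of columns);
* `no_quasipolynomial_labelLevelled_cover` — **`MonotoneCoverHard` HOLDS for label-levelled Pfaffian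
  covers**.

So `stub_width` and the crux can only fail on covers in which one and the same variable `x_{k l}` is read
at two different levels by two weight-nonzero perfect matchings.  VP ≠ VNP is not moved;
`MonotoneCoverHard` stays open.  No definitions.
-/

namespace Summit.ValiantsHypothesis.ValiantsHypothesis.Theorems.PolyaContinuedMonotoneCoverHard

-- summit = sub-problem name (single-conjunct summit, D-0017 layout), so the namespace repeats it
set_option linter.dupNamespace false

open scoped Classical
open Finset
open Literature.Computability.AlgebraicComplexity (perPoly)
open Summit.ValiantsHypothesis.ValiantsHypothesis.Theorems.PolyaContinued.MonotoneCoverHardRectangle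
  (exists_labels aeval_permanent_cover perPoly_eq_sum_monomial label_bijection pexp_injective
    pexp_apply)

/-- **Exchange ⇒ rows or columns.**  If `L : Fin n × Fin n → ℕ` satisfies the exchange identity
`[L(k,l) = ℓ] + [L(k',l') = ℓ] = [L(k,l') = ℓ] + [L(k',l) = ℓ]` for all `ℓ` and all `k ≠ k'`,
`l ≠ l'`, then `L` is constant on every row or constant on every column. -/
theorem rowConst_or_colConst_of_exchange {n : ℕ} (L : Fin n × Fin n → ℕ)
    (hex : ∀ (ℓ : ℕ) (k k' l l' : Fin n), k ≠ k' → l ≠ l' →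
      (if L (k, l) = ℓ then 1 else 0) + (if L (k', l') = ℓ then 1 else 0) =
        (if L (k, l') = ℓ then 1 else 0) + (if L (k', l) = ℓ then (1 : ℕ) else 0)) :
    (∀ k l l', L (k, l) = L (k, l')) ∨ (∀ k k' l, L (k, l) = L (k', l)) := by
  by_cases hrow : ∀ k l l', L (k, l) = L (k, l')
  · exact Or.inl hrow
  right
  push Not at hrow
  obtain ⟨k₀, l₁, l₂, hne⟩ := hrow
  have hl12 : l₁ ≠ l₂ := fun h => hne (by rw [h])
  -- every row agrees with row `k₀` on the columns `l₁`, `l₂`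
  have hcol1 : ∀ k, L (k, l₁) = L (k₀, l₁) := by
    intro k
    by_cases hk : k = k₀
    · rw [hk]
    have h := hex (L (k₀, l₁)) k₀ k l₁ l₂ (Ne.symm hk) hl12
    rw [if_pos rfl, if_neg (Ne.symm hne)] at h
    by_cases h1 : L (k, l₁) = L (k₀, l₁)
    · exact h1
    · rw [if_neg h1] at h
      by_cases h2 : L (k, l₂) = L (k₀, l₁)
      · rw [if_pos h2] at h; omega
      · rw [if_neg h2] at h; omega
  have hcol2 : ∀ k, L (k, l₂) = L (k₀, l₂) := by
    intro k
    by_cases hk : k = k₀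
    · rw [hk]
    have h := hex (L (k₀, l₂)) k₀ k l₂ l₁ (Ne.symm hk) hl12.symm
    rw [if_pos rfl, if_neg hne] at h
    by_cases h1 : L (k, l₂) = L (k₀, l₂)
    · exact h1
    · rw [if_neg h1] at h
      by_cases h2 : L (k, l₁) = L (k₀, l₂)
      · rw [if_pos h2] at h; omega
      · rw [if_neg h2] at h; omega
  intro k k' l
  by_cases hkk : k = k'
  · rw [hkk]
  by_cases hℓ : L (k, l) = L (k₀, l₂)
  · -- compare with column `l₁`
    have hl1 : l ≠ l₁ := by
      intro h; rw [h, hcol1] at hℓ; exact hne hℓ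
    have h := hex (L (k, l)) k k' l l₁ hkk hl1
    have hA : ¬ L (k₀, l₁) = L (k, l) := fun h' => hne (h'.trans hℓ)
    rw [if_pos rfl, hcol1 k', hcol1 k, if_neg hA] at h
    by_cases h1 : L (k', l) = L (k, l)
    · exact h1.symm
    · rw [if_neg h1] at h; omega
  · -- compare with column `l₂`
    have hl2 : l ≠ l₂ := by
      intro h; rw [h, hcol2] at hℓ; exact hℓ rfl
    have h := hex (L (k, l)) k k' l l₂ hkk hl2
    have hA : ¬ L (k₀, l₂) = L (k, l) := fun h' => hℓ h'.symm
    rw [if_pos rfl, hcol2 k', hcol2 k, if_neg hA] at h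
    by_cases h1 : L (k', l) = L (k, l)
    · exact h1.symm
    · rw [if_neg h1] at h; omega

section Cover

variable {m n : ℕ} (E : Finset (Fin m × Fin m)) (a : Fin m × Fin m → MvPolynomial (Fin n × Fin n) ℂ)
  (ha : ∀ e, (∃ j, a e = MvPolynomial.X j) ∨ a e = 0 ∨ a e = 1)
  (hper : perPoly (Fin n) ℂ =
    MvPolynomial.aeval a (Matrix.of fun i j => if (i, j) ∈ E then MvPolynomial.X (i, j) else 0 :
        Matrix (Fin m) (Fin m) (MvPolynomial (Fin m × Fin m) ℂ)).permanent)

include ha hper in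
/-- **Every permutation is realised.**  In a cover of `per_n` every permutation `σ` of `Fin n` is the
label permutation of some weight-nonzero perfect matching: its edges carry all the labels
`x_{k, σ k}`. -/
theorem exists_good_of_perm (σ : Equiv.Perm (Fin n)) :
    ∃ τ : Equiv.Perm (Fin m), (∀ i, (i, τ i) ∈ E ∧ a (i, τ i) ≠ 0) ∧
      ∀ k, ∃ i, a (i, τ i) = MvPolynomial.X (k, σ k) := by
  obtain ⟨δ, hδ, -, hδ0⟩ := exists_labels a ha
  set G := univ.filter fun τ : Equiv.Perm (Fin m) => ∀ i, (i, τ i) ∈ E ∧ a (i, τ i) ≠ 0 with hG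
  have hsum : ∑ τ ∈ G, MvPolynomial.monomial (∑ i, δ (i, τ i)) (1 : ℂ) =
      ∑ σ : Equiv.Perm (Fin n), MvPolynomial.monomial (∑ k, Finsupp.single (k, σ k) 1) (1 : ℂ) := by
    rw [← aeval_permanent_cover E a δ hδ G hG, ← hper, perPoly_eq_sum_monomial]
  obtain ⟨-, -, hsurj⟩ := label_bijection G (fun τ => ∑ i, δ (i, τ i))
    (fun σ : Equiv.Perm (Fin n) => ∑ k, Finsupp.single (k, σ k) (1 : ℕ)) pexp_injective hsum
  obtain ⟨τ, hτG, hτσ⟩ := hsurj σ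
  have hτ : ∀ i, (i, τ i) ∈ E ∧ a (i, τ i) ≠ 0 := by
    rw [hG] at hτG; exact (mem_filter.1 hτG).2
  refine ⟨τ, hτ, fun k => ?_⟩
  have h1 : (∑ i, δ (i, τ i)) (k, σ k) = 1 := by
    rw [hτσ, pexp_apply, if_pos rfl]
  rw [Finsupp.finsetSum_apply] at h1
  obtain ⟨i, -, hi⟩ := Finset.exists_ne_zero_of_sum_ne_zero (by rw [h1]; exact one_ne_zero)
  by_cases hv : ∃ j, a (i, τ i) = MvPolynomial.X j
  · obtain ⟨v, hv⟩ := hv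
    have h2 := hδ (i, τ i) (hτ i).2
    rw [hv] at h2
    have h3 : δ (i, τ i) = Finsupp.single v 1 :=
      (MvPolynomial.monomial_left_injective (one_ne_zero' ℂ) h2).symm
    rw [h3, Finsupp.single_apply] at hi
    by_cases hvk : v = (k, σ k)
    · exact ⟨i, by rw [hv, hvk]⟩
    · rw [if_neg hvk] at hi
      exact absurd rfl hi
  · rw [hδ0 _ hv, Finsupp.zero_apply] at hi
    exact absurd rfl hi

variable (g : Fin m ⊕ Fin m → ℕ)
  (hvar : ∀ i j, (i, j) ∈ E → (∃ k, a (i, j) = MvPolynomial.X k) →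
    g (Sum.inr j) = g (Sum.inl i) + 1)
  (hone : ∀ i j, (i, j) ∈ E → a (i, j) ≠ 0 → (¬ ∃ k, a (i, j) = MvPolynomial.X k) →
    g (Sum.inr j) = g (Sum.inl i))
  (L : Fin n × Fin n → ℕ)
  (hL : ∀ i j, (i, j) ∈ E → ∀ v : Fin n × Fin n, a (i, j) = MvPolynomial.X v → g (Sum.inl i) = L v)

include ha hper hL in
/-- In a label-levelled cover, the width of level `ℓ` read off a matching realising `σ` is the number of
label-rows `k` with `L (k, σ k) = ℓ`. -/
theorem varCount_eq_card_label (σ : Equiv.Perm (Fin n)) (τ : Equiv.Perm (Fin m))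
    (hτ : ∀ i, (i, τ i) ∈ E ∧ a (i, τ i) ≠ 0) (hlab : ∀ k, ∃ i, a (i, τ i) = MvPolynomial.X (k, σ k))
    (ℓ : ℕ) :
    (univ.filter fun i : Fin m => (∃ k, a (i, τ i) = MvPolynomial.X k) ∧ g (Sum.inl i) = ℓ).card =
      (univ.filter fun k : Fin n => L (k, σ k) = ℓ).card := by
  obtain ⟨σ', hσ'1, hσ'2⟩ := exists_perm_labels E a ha hper τ hτ
  have hσσ : ∀ k, σ' k = σ k := fun k => by
    obtain ⟨i, hi⟩ := hlab k
    exact hσ'1 i _ hi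
  choose ir hir using hlab
  have hkr' : ∀ i, (∃ k, a (i, τ i) = MvPolynomial.X k) →
      ∃ k : Fin n, a (i, τ i) = MvPolynomial.X (k, σ k) := by
    rintro i ⟨v, hv⟩
    exact ⟨v.1, by rw [hv, ← hσσ, hσ'1 i v hv]⟩
  rcases isEmpty_or_nonempty (Fin n) with hn | hn
  · -- no variables at all
    have h1 : (univ.filter fun i : Fin m =>
        (∃ k, a (i, τ i) = MvPolynomial.X k) ∧ g (Sum.inl i) = ℓ) = ∅ := by
      refine Finset.filter_false_of_mem fun i _ => ?_
      rintro ⟨⟨v, -⟩, -⟩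
      exact hn.elim v.1
    rw [h1, Finset.card_empty, Finset.univ_eq_empty, Finset.filter_empty, Finset.card_empty]
  choose! kr hkr using hkr'
  refine Finset.card_nbij' kr ir ?_ ?_ ?_ ?_
  · intro i hi
    have hi' := (Finset.mem_filter.1 (Finset.mem_coe.1 hi)).2
    have h1 := hkr i hi'.1
    refine Finset.mem_coe.2 (Finset.mem_filter.2 ⟨Finset.mem_univ _, ?_⟩)
    rw [← hL i (τ i) (hτ i).1 _ h1, hi'.2]
  · intro k hk
    have hk' := (Finset.mem_filter.1 (Finset.mem_coe.1 hk)).2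
    refine Finset.mem_coe.2 (Finset.mem_filter.2 ⟨Finset.mem_univ _, ⟨_, hir k⟩, ?_⟩)
    rw [hL (ir k) (τ (ir k)) (hτ _).1 _ (hir k), hk']
  · intro i hi
    have hi' := (Finset.mem_filter.1 (Finset.mem_coe.1 hi)).2
    obtain ⟨i₀, -, huniq⟩ := hσ'2 (kr i)
    have h1 := huniq i (by rw [hσσ]; exact hkr i hi'.1)
    have h2 := huniq (ir (kr i)) (by rw [hσσ]; exact hir (kr i))
    rw [h2, ← h1]
  · intro k hk
    have h1 := hkr (ir k) ⟨_, hir k⟩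
    rw [hir k] at h1
    have h2 := (Prod.ext_iff.1 (MvPolynomial.X_injective h1)).1
    exact h2.symm

include ha hper hvar hone hL in
/-- **The exchange identity of a label-levelled cover.**  For `k ≠ k'`, `l ≠ l'` and every `ℓ`,
`[L(k,l) = ℓ] + [L(k',l') = ℓ] = [L(k,l') = ℓ] + [L(k',l) = ℓ]`: compare the widths of level `ℓ`
(matching-independent, `varCount_eq`) read off the matchings realising a permutation `σ` with
`σ k = l`, `σ k' = l'` and the permutation `σ ∘ (k k')`. -/
theorem exchange_of_labelLevelled (ℓ : ℕ) (k k' l l' : Fin n) (hkk : k ≠ k') (hll : l ≠ l') :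
    (if L (k, l) = ℓ then 1 else 0) + (if L (k', l') = ℓ then 1 else 0) =
      (if L (k, l') = ℓ then 1 else 0) + (if L (k', l) = ℓ then (1 : ℕ) else 0) := by
  -- a permutation with `σ k = l`, `σ k' = l'`
  set s₁ : Equiv.Perm (Fin n) := Equiv.swap k l with hs₁
  have hs₁k : s₁ k = l := by rw [hs₁, Equiv.swap_apply_left]
  have hs₁k' : s₁ k' ≠ l := by
    intro h
    rw [← hs₁k] at h
    exact hkk (s₁.injective h).symm
  set σ : Equiv.Perm (Fin n) := Equiv.swap (s₁ k') l' * s₁ with hσ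
  have hσk : σ k = l := by
    rw [hσ, Equiv.Perm.mul_apply, hs₁k, Equiv.swap_apply_of_ne_of_ne hs₁k'.symm hll]
  have hσk' : σ k' = l' := by
    rw [hσ, Equiv.Perm.mul_apply, Equiv.swap_apply_left]
  set σ' : Equiv.Perm (Fin n) := σ * Equiv.swap k k' with hσ'
  have hσ'k : σ' k = l' := by
    rw [hσ', Equiv.Perm.mul_apply, Equiv.swap_apply_left, hσk']
  have hσ'k' : σ' k' = l := by
    rw [hσ', Equiv.Perm.mul_apply, Equiv.swap_apply_right, hσk]
  have hσ'x : ∀ x, x ≠ k → x ≠ k' → σ' x = σ x := by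
    intro x h1 h2
    rw [hσ', Equiv.Perm.mul_apply, Equiv.swap_apply_of_ne_of_ne h1 h2]
  -- matchings realising `σ`, `σ'`; their level-`ℓ` widths agree
  obtain ⟨τ, hτ, hlab⟩ := exists_good_of_perm E a ha hper σ
  obtain ⟨τ', hτ', hlab'⟩ := exists_good_of_perm E a ha hper σ'
  have hw := varCount_eq E a g hvar hone τ τ' hτ hτ' ℓ
  rw [varCount_eq_card_label E a ha hper g L hL σ τ hτ hlab ℓ,
    varCount_eq_card_label E a ha hper g L hL σ' τ' hτ' hlab' ℓ,
    Finset.card_filter, Finset.card_filter] at hw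
  -- split off the terms `k`, `k'`
  have hk'mem : k' ∈ univ.erase k := Finset.mem_erase.2 ⟨hkk.symm, mem_univ _⟩
  have hsplit : ∀ ρ : Equiv.Perm (Fin n),
      ∑ x, (if L (x, ρ x) = ℓ then (1 : ℕ) else 0) =
        (if L (k, ρ k) = ℓ then 1 else 0) + ((if L (k', ρ k') = ℓ then 1 else 0) +
          ∑ x ∈ (univ.erase k).erase k', (if L (x, ρ x) = ℓ then 1 else 0)) := by
    intro ρ
    have h1 := Finset.add_sum_erase (univ : Finset (Fin n))
      (fun x => if L (x, ρ x) = ℓ then (1 : ℕ) else 0) (mem_univ k)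
    have h2 := Finset.add_sum_erase (univ.erase k)
      (fun x => if L (x, ρ x) = ℓ then (1 : ℕ) else 0) hk'mem
    rw [← h1, ← h2]
  have hrest : ∑ x ∈ (univ.erase k).erase k', (if L (x, σ' x) = ℓ then (1 : ℕ) else 0) =
      ∑ x ∈ (univ.erase k).erase k', (if L (x, σ x) = ℓ then 1 else 0) := by
    refine Finset.sum_congr rfl fun x hx => ?_
    have hx1 : x ≠ k' := (Finset.mem_erase.1 hx).1
    have hx2 : x ≠ k := (Finset.mem_erase.1 (Finset.mem_erase.1 hx).2).1
    rw [hσ'x x hx2 hx1]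
  rw [hsplit σ, hsplit σ', hrest, hσk, hσk', hσ'k, hσ'k'] at hw
  omega

include ha hper hvar hone hL in
/-- **Label-levelled ⇒ row-levelled or column-levelled.** -/
theorem rowLevelled_or_colLevelled_of_labelLevelled :
    (∃ L₁ : Fin n → ℕ, ∀ i j, (i, j) ∈ E → ∀ v : Fin n × Fin n,
        a (i, j) = MvPolynomial.X v → g (Sum.inl i) = L₁ v.1) ∨
      (∃ L₂ : Fin n → ℕ, ∀ i j, (i, j) ∈ E → ∀ v : Fin n × Fin n,
        a (i, j) = MvPolynomial.X v → g (Sum.inl i) = L₂ v.2) := by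
  rcases rowConst_or_colConst_of_exchange L
      (fun ℓ k k' l l' hkk hll => exchange_of_labelLevelled E a ha hper g hvar hone L hL ℓ k k' l l'
        hkk hll) with hrow | hcol
  · refine Or.inl ⟨fun k => L (k, k), fun i j hij v hv => ?_⟩
    obtain ⟨k, l⟩ := v
    rw [hL i j hij _ hv]
    exact hrow k l k
  · refine Or.inr ⟨fun l => L (l, l), fun i j hij v hv => ?_⟩
    obtain ⟨k, l⟩ := v
    rw [hL i j hij _ hv]
    exact hcol k l l

end Cover

/-- **The crux HOLDS for label-levelled Pfaffian covers**: there is no quasi-polynomial family of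
label-bijective Pfaffian covers of the permanent that are levelled with the row level of every variable
edge a function of its label (the variable `x_{k l}` it carries). -/
theorem no_quasipolynomial_labelLevelled_cover :
    ¬ ∃ c : ℕ, ∀ n : ℕ, ∃ m : ℕ, m ≤ 2 ^ ((Nat.log 2 n + c) ^ c) ∧
      ∃ (E : Finset (Fin m × Fin m)) (a : Fin m × Fin m → MvPolynomial (Fin n × Fin n) ℂ),
        (∃ s : Fin m × Fin m → ℂ, (∀ e, s e = 1 ∨ s e = -1) ∧
          (Matrix.of fun i j => if (i, j) ∈ E then MvPolynomial.C (s (i, j)) * MvPolynomial.X (i, j)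
              else 0 : Matrix (Fin m) (Fin m) (MvPolynomial (Fin m × Fin m) ℂ)).det =
            (Matrix.of fun i j => if (i, j) ∈ E then MvPolynomial.X (i, j) else 0 :
              Matrix (Fin m) (Fin m) (MvPolynomial (Fin m × Fin m) ℂ)).permanent) ∧
        (∀ e, (∃ j, a e = MvPolynomial.X j) ∨ a e = 0 ∨ a e = 1) ∧
        perPoly (Fin n) ℂ =
          MvPolynomial.aeval a (Matrix.of fun i j => if (i, j) ∈ E then MvPolynomial.X (i, j) else 0 :
              Matrix (Fin m) (Fin m) (MvPolynomial (Fin m × Fin m) ℂ)).permanent ∧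
        ∃ g : Fin m ⊕ Fin m → ℕ,
          (∀ i j, (i, j) ∈ E → (∃ k, a (i, j) = MvPolynomial.X k) →
            g (Sum.inr j) = g (Sum.inl i) + 1) ∧
          (∀ i j, (i, j) ∈ E → a (i, j) ≠ 0 → (¬ ∃ k, a (i, j) = MvPolynomial.X k) →
            g (Sum.inr j) = g (Sum.inl i)) ∧
          ∃ L : Fin n × Fin n → ℕ, ∀ i j, (i, j) ∈ E → ∀ v : Fin n × Fin n,
            a (i, j) = MvPolynomial.X v → g (Sum.inl i) = L v := by
  rintro ⟨c, hc⟩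
  apply no_quasipolynomial_width_two_cover
  refine ⟨c, fun n => ?_⟩
  obtain ⟨m, hm, E, a, hsig, ha, hper, g, hvar, hone, L, hL⟩ := hc n
  refine ⟨m, hm, E, a, hsig, ha, hper, g, hvar, hone, fun τ hτ ℓ => ?_⟩
  have hg : ∀ τ : Equiv.Perm (Fin m), (∀ i, (i, τ i) ∈ E ∧ a (i, τ i) ≠ 0) → ∀ i,
      ((∃ k, a (i, τ i) = MvPolynomial.X k) → g (Sum.inr (τ i)) = g (Sum.inl i) + 1) ∧
      ((¬ ∃ k, a (i, τ i) = MvPolynomial.X k) → g (Sum.inr (τ i)) = g (Sum.inl i)) :=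
    fun τ hτ i => ⟨fun hv => hvar i (τ i) (hτ i).1 hv, fun hv => hone i (τ i) (hτ i).1 (hτ i).2 hv⟩
  rcases rowLevelled_or_colLevelled_of_labelLevelled E a ha hper g hvar hone L hL with
    ⟨L₁, hL₁⟩ | ⟨L₂, hL₂⟩
  · exact width_le_two_of_rowLevelled n m E a hsig ha hper g hg L₁
      (fun τ hτ i v hv => hL₁ i (τ i) (hτ i).1 v hv) τ hτ ℓ
  · exact width_le_two_of_colLevelled n m E a hsig ha hper g hg L₂
      (fun τ hτ i v hv => hL₂ i (τ i) (hτ i).1 v hv) τ hτ ℓ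

end Summit.ValiantsHypothesis.ValiantsHypothesis.Theorems.PolyaContinuedMonotoneCoverHard
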